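import Mathlib
import Summits.NavierStokesRegularity.NavierStokesRegularity.Theorems.FilamentSkeletonRssSkeletonJ1RFrameDefs
import Summits.NavierStokesRegularity.NavierStokesRegularity.Theorems.FilamentSkeletonRssClause13LinearisedMap

/-!
# Route `FilamentSkeletonRss` · crux `SkeletonJ1R` (stmt-NavierStokesRegularity-23610) · registered line `streamline_kantorovich_R`
# — brick for stubs L / K: the FIRST VARIATION of the switched normal defect `s ↦ swDefect(x + sY) j τ` EXISTS and is EXPLICIT

Lead `ns-fsr-lead-23610` (g0), `--supports stmt-NavierStokesRegularity-23610 --as helper`.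

WHY.  Stub L (`ReferenceInjectivityL`) is stated with the hypothesis `HasDerivAt (fun s => swDefect Γ Rb γ α M (x + s•Y) j τ) D 0 ∧ ‖D‖ ≤ L`; stub K
must PRODUCE that derivative for its Newton step, and the disprover needs its closed form.  This file assembles it from the tree's clause-13
calculus (`MatchedKernel.velocityPart_hasDerivAt` — variation of the regularised Biot–Savart field with a moving evaluation point, p-landed lane
19175 — instantiated at RIGID UNIT CORES `Aa ≡ 1`, which is the crux's `bsField`; `MatchedKernel.hasDerivAt_tangencyDefect` — the tangential
projection) plus the chain rule through the switch weight `σ = switchWeight ℓ 1` and the model `M`: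
`swDefect_hasDerivAt` — for `C¹` filaments `x k` (`‖x_k′‖ ≤ 1`, linear growth), `C¹` bounded variations `Y k` (`‖Y‖, ‖Y′‖ ≤ B`), `M`
differentiable at `x_j τ`, and `x_j′ τ ≠ 0`, the map `s ↦ swDefect Γ Rb γ α M (x + s•Y) j τ` has at `0` the derivative
`S′ − ((⟪S₀,P⟫/‖P‖²)•P′ + (((⟪S₀,P′⟫ + ⟪S′,P⟫)‖P‖² − ⟪S₀,P⟫·2⟪P,P′⟫)/‖P‖⁴)•P)` with `P = x_j′ τ`, `P′ = Y_j′ τ`,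
`S₀ = σ₀ V₀ + (1−σ₀) M(x_j τ)`, `S′ = σ′•V₀ + σ₀•V′ − σ′•M(x_j τ) + (1−σ₀)•DM(x_j τ)Y_j τ`, `σ₀ = σ(x_j τ)`, `σ′ = Dσ(x_j τ)Y_j τ`, `V₀` the true
field at `x_j τ` and `V′` the clause-13 variation `W′` of `velocityPart_hasDerivAt` (explicit integral operator).

HONEST FRAMING.  Calculus for the ∃-side of a HYPOTHETICAL filament-type rotating-self-similar blow-up skeleton (MODEL rung, negative side); nothing
here is a claim about Navier–Stokes regularity or blow-up; stubs L, K and the crux stay OPEN.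
-/

set_option linter.dupNamespace false -- `NavierStokesRegularity.NavierStokesRegularity` path/namespace repetition is the tree convention

noncomputable section

namespace Summit.NavierStokesRegularity.NavierStokesRegularity.Theorems.SkeletonJ1RFrame

open Set Function Filter MeasureTheory Real Topology
open Literature.Analysis.FluidPDE
open Summit.NavierStokesRegularity.NavierStokesRegularity.Theorems.MatchedKernel
open scoped InnerProductSpace BigOperators

/-- The crux's `bsField` is the matched-kernel field of the clause-13 calculus at rigid unit cores `Aa ≡ 1`. [folklore] -/
theorem bsField_eq_matched {N : ℕ} (Γ : ℝ) (γ : Fin N → ℝ) (Z : Fin N → ℝ → EuclideanSpace ℝ (Fin 3)) (y : EuclideanSpace ℝ (Fin 3)) :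
    bsField Γ γ Z y = ∑ k, (Γ * γ k / (4 * Real.pi)) • ∫ σ : ℝ,
      ((‖y - Z k σ‖ ^ 2 + Real.exp (-(1 + Real.eulerMascheroniConstant - Real.log 2)) * (fun (_ : Fin N) (_ : ℝ) => (1:ℝ)) k σ) ^
          (3 / 2 : ℝ))⁻¹ • cross (deriv (Z k) σ) (y - Z k σ) := rfl

/-- **First variation of the TRUE field along the variation with moving evaluation point** (rigid unit cores):
`s ↦ trueField Γ γ α (x + s•Y) (x_j τ + s•Y_j τ)` has at `0` the clause-13 derivative `W′`. [folklore] -/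
theorem trueField_hasDerivAt_variation {N : ℕ} {Γ α c C B : ℝ} {γ : Fin N → ℝ} {x Y : Fin N → ℝ → EuclideanSpace ℝ (Fin 3)}
    (hc : 0 < c) (hx : ∀ k, ContDiff ℝ 1 (x k)) (hx1 : ∀ k σ, ‖deriv (x k) σ‖ ≤ 1) (hxg : ∀ k σ, c * |σ| - C ≤ ‖x k σ‖)
    (hY : ∀ k, ContDiff ℝ 1 (Y k)) (hB : 0 ≤ B) (hYb : ∀ k σ, ‖Y k σ‖ ≤ B) (hY'b : ∀ k σ, ‖deriv (Y k) σ‖ ≤ B) (j : Fin N) (τ : ℝ) :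
    HasDerivAt (fun s : ℝ => trueField Γ γ α (fun k σ => x k σ + s • Y k σ) (x j τ + s • Y j τ))
      ((∑ k, (Γ * γ k / (4 * Real.pi)) • ∫ σ : ℝ,
          ((-3 * ⟪x j τ - x k σ, Y j τ - Y k σ⟫_ℝ *
              ((‖x j τ - x k σ‖ ^ 2 + Real.exp (-(1 + Real.eulerMascheroniConstant - Real.log 2)) * 1) ^ (5 / 2 : ℝ))⁻¹) •
            cross (deriv (x k) σ) (x j τ - x k σ) +
          ((‖x j τ - x k σ‖ ^ 2 + Real.exp (-(1 + Real.eulerMascheroniConstant - Real.log 2)) * 1) ^ (3 / 2 : ℝ))⁻¹ •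
            (cross (deriv (x k) σ) (Y j τ - Y k σ) + cross (deriv (Y k) σ) (x j τ - x k σ))))
        + (1 / 2 : ℝ) • Y j τ - α • cross (EuclideanSpace.single 2 1) (Y j τ)) 0 := by
  have h := velocityPart_hasDerivAt (u := fun Z y => bsField Γ γ Z y) (Aa := fun _ _ => (1:ℝ)) (α := α)
    (fun Z y => bsField_eq_matched Γ γ Z y) hc hx hx1 hxg (fun _ => continuous_const) one_pos (fun _ _ => le_rfl) hY hB hYb hY'b j τ
  exact h

/-- **FIRST VARIATION OF THE SWITCHED NORMAL DEFECT.**  Under the hypotheses of `trueField_hasDerivAt_variation`, with `M` differentiable at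
`x_j τ` and `x_j′ τ ≠ 0`, `s ↦ swDefect Γ Rb γ α M (x + s•Y) j τ` is differentiable at `0` with the explicit derivative of the module docstring:
with `ℓ = Rb√(Γ log Γ)`, `σ₀ = switchWeight ℓ 1 (x_j τ)`, `σ′ = D(switchWeight ℓ 1)(x_j τ)·Y_j τ`, `V₀ = trueField x (x_j τ)`, `V′` the derivative of
`trueField_hasDerivAt_variation`, `S₀ = σ₀V₀ + (1−σ₀)M(x_j τ)`, `S′ = σ′V₀ + σ₀V′ − σ′M(x_j τ) + (1−σ₀)DM(x_j τ)Y_j τ`, `P = x_j′ τ`, `P′ = Y_j′ τ`,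
the derivative is `S′ − ((⟪S₀,P⟫/‖P‖²)P′ + (((⟪S₀,P′⟫ + ⟪S′,P⟫)‖P‖² − ⟪S₀,P⟫·2⟪P,P′⟫)/‖P‖⁴)P)`. [folklore] -/
theorem swDefect_hasDerivAt {N : ℕ} {Γ Rb α : ℝ} {γ : Fin N → ℝ} {x Y : Fin N → ℝ → EuclideanSpace ℝ (Fin 3)}
    {M : EuclideanSpace ℝ (Fin 3) → EuclideanSpace ℝ (Fin 3)} (hx : ∀ k, ContDiff ℝ 1 (x k)) (hY : ∀ k, ContDiff ℝ 1 (Y k))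
    (j : Fin N) (τ : ℝ) (hM : DifferentiableAt ℝ M (x j τ)) (hP : deriv (x j) τ ≠ 0) {V' : EuclideanSpace ℝ (Fin 3)}
    (hV' : HasDerivAt (fun s : ℝ => trueField Γ γ α (fun k σ => x k σ + s • Y k σ) (x j τ + s • Y j τ)) V' 0) :
    HasDerivAt (fun s : ℝ => swDefect Γ Rb γ α M (fun k σ => x k σ + s • Y k σ) j τ)
      ((fderiv ℝ (switchWeight (Rb * Real.sqrt (Γ * Real.log Γ)) 1) (x j τ) (Y j τ) • trueField Γ γ α x (x j τ)
          + switchWeight (Rb * Real.sqrt (Γ * Real.log Γ)) 1 (x j τ) • V'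
          - fderiv ℝ (switchWeight (Rb * Real.sqrt (Γ * Real.log Γ)) 1) (x j τ) (Y j τ) • M (x j τ)
          + (1 - switchWeight (Rb * Real.sqrt (Γ * Real.log Γ)) 1 (x j τ)) • fderiv ℝ M (x j τ) (Y j τ))
        - ((⟪switchWeight (Rb * Real.sqrt (Γ * Real.log Γ)) 1 (x j τ) • trueField Γ γ α x (x j τ)
                + (1 - switchWeight (Rb * Real.sqrt (Γ * Real.log Γ)) 1 (x j τ)) • M (x j τ), deriv (x j) τ⟫_ℝ / ‖deriv (x j) τ‖ ^ 2) •
              deriv (Y j) τ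
            + (((⟪switchWeight (Rb * Real.sqrt (Γ * Real.log Γ)) 1 (x j τ) • trueField Γ γ α x (x j τ)
                    + (1 - switchWeight (Rb * Real.sqrt (Γ * Real.log Γ)) 1 (x j τ)) • M (x j τ), deriv (Y j) τ⟫_ℝ
                  + ⟪(fderiv ℝ (switchWeight (Rb * Real.sqrt (Γ * Real.log Γ)) 1) (x j τ) (Y j τ) • trueField Γ γ α x (x j τ)
                      + switchWeight (Rb * Real.sqrt (Γ * Real.log Γ)) 1 (x j τ) • V'
                      - fderiv ℝ (switchWeight (Rb * Real.sqrt (Γ * Real.log Γ)) 1) (x j τ) (Y j τ) • M (x j τ)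
                      + (1 - switchWeight (Rb * Real.sqrt (Γ * Real.log Γ)) 1 (x j τ)) • fderiv ℝ M (x j τ) (Y j τ)),
                    deriv (x j) τ⟫_ℝ) * ‖deriv (x j) τ‖ ^ 2
                - ⟪switchWeight (Rb * Real.sqrt (Γ * Real.log Γ)) 1 (x j τ) • trueField Γ γ α x (x j τ)
                    + (1 - switchWeight (Rb * Real.sqrt (Γ * Real.log Γ)) 1 (x j τ)) • M (x j τ), deriv (x j) τ⟫_ℝ *
                  (2 * ⟪deriv (x j) τ, deriv (Y j) τ⟫_ℝ)) / (‖deriv (x j) τ‖ ^ 2) ^ 2) • deriv (x j) τ)) 0 := by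
  set ℓ := Rb * Real.sqrt (Γ * Real.log Γ) with hℓ
  -- junk-zero identities
  have e1 : (fun k σ => x k σ + (0:ℝ) • Y k σ) = x := by funext k σ; simp
  have e2 : x j τ + (0:ℝ) • Y j τ = x j τ := by simp
  have e3 : deriv (fun σ => x j σ + (0:ℝ) • Y j σ) τ = deriv (x j) τ := by
    rw [deriv_add_smul_curve (hx j) (hY j) 0 τ, zero_smul, add_zero]
  -- the moving point and the tangent
  have hp : HasDerivAt (fun s : ℝ => x j τ + s • Y j τ) (Y j τ) 0 := by
    simpa using ((hasDerivAt_id' (x := (0:ℝ))).smul_const (Y j τ)).const_add (x j τ)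
  have hPt : HasDerivAt (fun s : ℝ => deriv (fun σ => x j σ + s • Y j σ) τ) (deriv (Y j) τ) 0 := by
    have heq : (fun s : ℝ => deriv (fun σ => x j σ + s • Y j σ) τ) = fun s => deriv (x j) τ + s • deriv (Y j) τ :=
      funext fun s => deriv_add_smul_curve (hx j) (hY j) s τ
    rw [heq]
    simpa using ((hasDerivAt_id' (x := (0:ℝ))).smul_const (deriv (Y j) τ)).const_add (deriv (x j) τ)
  -- the switch weight along the moving point
  have hσd : DifferentiableAt ℝ (switchWeight ℓ 1) (x j τ) := by
    have : ContDiff ℝ 1 (switchWeight ℓ 1) := by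
      unfold switchWeight switchProfile
      exact (Real.smoothTransition.contDiff (n := 1)).comp
        (contDiff_const.sub ((((contDiff_norm_sq ℝ (E := EuclideanSpace ℝ (Fin 3))).div_const _).add contDiff_const).sub contDiff_const))
    exact (this.differentiable one_ne_zero).differentiableAt
  have hσ : HasDerivAt (fun s : ℝ => switchWeight ℓ 1 (x j τ + s • Y j τ)) (fderiv ℝ (switchWeight ℓ 1) (x j τ) (Y j τ)) 0 := by
    exact hσd.hasFDerivAt.comp_hasDerivAt_of_eq (0:ℝ) hp e2.symm
  -- the model along the moving point
  have hMs : HasDerivAt (fun s : ℝ => M (x j τ + s • Y j τ)) (fderiv ℝ M (x j τ) (Y j τ)) 0 := by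
    exact hM.hasFDerivAt.comp_hasDerivAt_of_eq (0:ℝ) hp e2.symm
  -- the switched field S(s) and its derivative
  have hS0 := (hσ.smul hV').add (((hasDerivAt_const (0:ℝ) (1:ℝ)).sub hσ).smul hMs)
  have hS : HasDerivAt (fun s : ℝ => switchWeight ℓ 1 (x j τ + s • Y j τ) • trueField Γ γ α (fun k σ => x k σ + s • Y k σ) (x j τ + s • Y j τ)
      + (1 - switchWeight ℓ 1 (x j τ + s • Y j τ)) • M (x j τ + s • Y j τ))
      (fderiv ℝ (switchWeight ℓ 1) (x j τ) (Y j τ) • trueField Γ γ α x (x j τ) + switchWeight ℓ 1 (x j τ) • V'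
        - fderiv ℝ (switchWeight ℓ 1) (x j τ) (Y j τ) • M (x j τ) + (1 - switchWeight ℓ 1 (x j τ)) • fderiv ℝ M (x j τ) (Y j τ)) 0 := by
    refine HasDerivAt.congr_deriv (hS0.congr_of_eventuallyEq (Eventually.of_forall fun s => ?_)) ?_
    · simp only [Pi.add_apply, Pi.smul_apply', Pi.sub_apply]
    · simp only [Pi.sub_apply, zero_smul, add_zero, zero_sub, neg_smul, sub_smul, one_smul]
      abel
  -- assemble with the tangential projection
  have hproj := hasDerivAt_tangencyDefect (W := fun s : ℝ => switchWeight ℓ 1 (x j τ + s • Y j τ) •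
      trueField Γ γ α (fun k σ => x k σ + s • Y k σ) (x j τ + s • Y j τ) + (1 - switchWeight ℓ 1 (x j τ + s • Y j τ)) • M (x j τ + s • Y j τ))
    (P := fun s : ℝ => deriv (fun σ => x j σ + s • Y j σ) τ) hS hPt (by show deriv (fun σ => x j σ + (0:ℝ) • Y j σ) τ ≠ 0; rw [e3]; exact hP)
  simp only [e1, e2, e3] at hproj
  refine hproj.congr_of_eventuallyEq (Eventually.of_forall fun s => ?_)
  simp only [swDefect, switchedField, hℓ]

end Summit.NavierStokesRegularity.NavierStokesRegularity.Theorems.SkeletonJ1RFrame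

end
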